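import Literature.NumberTheory.Sieve.LinearEquationsInPrimesQualitative
import Literature.NumberTheory.Sieve.PrimeParallelograms
import HarnessLib

/-!
# Balog's theorem: tuples of primes all of whose pairwise means are prime (Green–Tao 2010, Example 4) — unconditional

Topic `Literature/NumberTheory/Sieve`. Sources: B. Green, T. Tao, *Linear equations in primes*,
Ann. of Math. 171 (2010), 1753–1850 (arXiv:math/0606088), §1, Example 4: "the system of forms
`(nᵢ + nⱼ + 1)_{1 ≤ i ≤ j ≤ d}` on `ℤ^d`, which counts `d`-tuples of primes `p₁, …, p_d` all of
whose midpoints `½(pᵢ + pⱼ)` are also prime, has complexity `1`" (the complexity-`1` class being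
the one that "can be treated by the Hardy–Littlewood circle method (see e.g. [Balog])"), and
A. Balog, *Linear equations in primes*, Mathematika 39 (1992), 367–378 [Balog1992] (also
*The prime k-tuplets conjecture on average*, in: Analytic Number Theory (Allerton Park 1989),
Birkhäuser 1990 [Balog1990]), to whom Green–Tao attribute the theorem that for every `d` there are
infinitely many `d`-tuples of odd primes all of whose midpoints `½(pᵢ + pⱼ)` are prime (Green–Tao state
Example 4 for `d ≥ 2`; the case `d = 1` is trivial and included below).

Contents (everything proved; the engine is `GreenTao2010_corollary19_atComplexity_one` and
`GreenTao2010_mainTheoremAtComplexity_one`, the Main Theorem of Green–Tao 2010 at complexity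
`≤ 1`, proved in the tree):

* `balogForm i j = nᵢ + nⱼ + 1`, `balogSystem d` — the Balog system indexed by an enumeration
  `balogPair` of the pairs `i ≤ j` (`balogCount d = #{(i, j) : i ≤ j}` forms);
* `complexity_balogSystem_le_one` — **its Cauchy–Schwarz complexity is `≤ 1` for every `d`**
  (explicit classes "forms through `nᵢ`" / "forms avoiding `nᵢ`" with integer witnesses);
* `balog_vonMangoldt_asymptotic` — the generalised Hardy–Littlewood asymptotic for the Balog
  system, unconditionally;
* `balog_pairwiseMeans_infinite` — **infinitely many `n ∈ ℤ^d_{>0}` with all `nᵢ + nⱼ + 1`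
  (`i, j` arbitrary, so all `2nᵢ + 1` and all means) prime**; `balog_primeTuples_infinite` — the
  same in Balog's wording: infinitely many `p : Fin d → ℕ` with every `pₐ` prime, every
  `pₐ + p_b` even and every `(pₐ + p_b)/2` prime.

## References

* [GreenTao2010] B. Green, T. Tao, Ann. of Math. (2) 171 (2010), 1753–1850, §1 Example 4,
  Cor. 1.9, Def. 1.5.
* [Balog1992] A. Balog, *Linear equations in primes*, Mathematika 39 (1992), 367–378 (the original
  circle-method proof; not held here — statement as reported in [GreenTao2010, Example 4]).
-/

noncomputable section

open Finset

namespace Literature.NumberTheory.Sieve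

variable {d : ℕ}

/-! ### The Balog system -/

/-- The form `nᵢ + nⱼ + 1` on `ℤ^d` (for `i = j`: `2nᵢ + 1`). [cite: GreenTao2010, Example 4] -/
def balogForm (i j : Fin d) : AffLinForm d :=
  ⟨fun l => (if l = i then 1 else 0) + (if l = j then 1 else 0), 1⟩

/-- The number `#{(i, j) : i ≤ j}` of forms of the Balog system. [cite: GreenTao2010, Example 4] -/
def balogCount (d : ℕ) : ℕ := Fintype.card {q : Fin d × Fin d // q.1 ≤ q.2}

/-- A fixed enumeration of the pairs `i ≤ j`. [cite: GreenTao2010, Example 4] -/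
def balogPair (k : Fin (balogCount d)) : Fin d × Fin d :=
  ((Fintype.equivFin {q : Fin d × Fin d // q.1 ≤ q.2}).symm k).1

/-- **The Balog system** `(nᵢ + nⱼ + 1)_{i ≤ j}` on `ℤ^d`. [cite: GreenTao2010, Example 4] -/
def balogSystem (d : ℕ) : Fin (balogCount d) → AffLinForm d :=
  fun k => balogForm (balogPair k).1 (balogPair k).2

/-- The enumerated pairs are ordered. [cite: GreenTao2010, Example 4] -/
theorem balogPair_le (k : Fin (balogCount d)) : (balogPair k).1 ≤ (balogPair k).2 :=
  ((Fintype.equivFin {q : Fin d × Fin d // q.1 ≤ q.2}).symm k).2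

/-- The enumeration is injective. [cite: GreenTao2010, Example 4] -/
theorem balogPair_injective : Function.Injective (balogPair (d := d)) :=
  Subtype.val_injective.comp (Fintype.equivFin _).symm.injective

/-- Every ordered pair is enumerated. [cite: GreenTao2010, Example 4] -/
theorem exists_balogPair_eq {a b : Fin d} (h : a ≤ b) : ∃ k : Fin (balogCount d), balogPair k = (a, b) :=
  ⟨Fintype.equivFin _ ⟨(a, b), h⟩, by simp [balogPair]⟩

/-- There is at least one form when `d ≥ 1`. [cite: GreenTao2010, Example 4] -/
theorem one_le_balogCount (hd : 1 ≤ d) : 1 ≤ balogCount d :=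
  Fintype.card_pos_iff.mpr ⟨⟨(⟨0, hd⟩, ⟨0, hd⟩), le_rfl⟩⟩

/-- `ψ̇_{ij}(f) = fᵢ + fⱼ`. [cite: GreenTao2010, Example 4] -/
@[simp] theorem linearPart_balogForm (i j : Fin d) (f : Fin d → ℤ) :
    (balogForm i j).linearPart f = f i + f j := by
  simp [balogForm, AffLinForm.linearPart, add_mul, Finset.sum_add_distrib]

/-- `ψ_{ij}(0) = 1`. [cite: GreenTao2010, Example 4] -/
@[simp] theorem balogForm_const (i j : Fin d) : (balogForm i j).const = 1 := rfl

/-- `ψ_{ij}(n) = nᵢ + nⱼ + 1`. [cite: GreenTao2010, Example 4] -/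
@[simp] theorem eval_balogForm (i j : Fin d) (n : Fin d → ℤ) :
    (balogForm i j).eval n = n i + n j + 1 := by
  rw [AffLinForm.eval_eq_linearPart_add_const, linearPart_balogForm, balogForm_const]

/-- The `k`-th form of the system evaluated. [cite: GreenTao2010, Example 4] -/
theorem eval_balogSystem (k : Fin (balogCount d)) (n : Fin d → ℤ) :
    (balogSystem d k).eval n = n (balogPair k).1 + n (balogPair k).2 + 1 :=
  eval_balogForm _ _ _

/-- The `k`-th linear part. [cite: GreenTao2010, Example 4] -/
theorem linearPart_balogSystem (k : Fin (balogCount d)) (f : Fin d → ℤ) :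
    (balogSystem d k).linearPart f = f (balogPair k).1 + f (balogPair k).2 :=
  linearPart_balogForm _ _ _

/-! ### Complexity one -/

/-- **The Balog system has complexity `≤ 1`** for every `d`: for the form `ψ_{ij}` (`i ≤ j`) cover
the other forms by the class of forms through `nᵢ` and the class of forms avoiding `nᵢ`; the
witnesses `f = eⱼ` (resp. `eᵢ − ∑_{m ≠ i} e_m` when `i = j`) and `f = eᵢ` kill the class but not
`ψ̇_{ij}`. [cite: GreenTao2010, Example 4 and Def. 1.5] -/
theorem complexity_balogSystem_le_one (d : ℕ) : complexity (balogSystem d) ≤ (1 : ℕ) := by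
  classical
  refine complexity_le_coe_iff.mpr fun k => ?_
  obtain ⟨i, j, hk⟩ : ∃ i j, balogPair k = (i, j) := ⟨_, _, rfl⟩
  have hij : i ≤ j := by have := balogPair_le k; rw [hk] at this; exact this
  have hPk : ∀ l, balogPair l = (i, j) → l = k := fun l hl => balogPair_injective (hl.trans hk.symm)
  refine ⟨![univ.filter (fun l => l ≠ k ∧ ((balogPair l).1 = i ∨ (balogPair l).2 = i)),
    univ.filter (fun l => ¬ ((balogPair l).1 = i ∨ (balogPair l).2 = i))], ?_,
    Fin.forall_fin_two.mpr ⟨?_, ?_⟩⟩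
  · intro l hl
    by_cases h : (balogPair l).1 = i ∨ (balogPair l).2 = i
    · exact ⟨0, by simp [hl, h]⟩
    · refine ⟨1, ?_⟩
      simp only [Matrix.cons_val_one, Matrix.cons_val_zero]
      exact Finset.mem_filter.mpr ⟨Finset.mem_univ _, h⟩
  · -- the class of forms through `nᵢ`
    simp only [Matrix.cons_val_zero]
    by_cases hd : i = j
    · subst hd
      refine not_memAffLinSpan_of_witness (fun m => if m = i then (1 : ℤ) else -1)
        (fun l hl => ?_) ?_
      · rw [Finset.mem_filter] at hl
        obtain ⟨-, hlk, hil⟩ := hl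
        rw [linearPart_balogSystem]
        have hne : ¬ ((balogPair l).1 = i ∧ (balogPair l).2 = i) := fun h =>
          hlk (hPk l (Prod.ext h.1 h.2))
        rcases hil with h1 | h2
        · have h2 : (balogPair l).2 ≠ i := fun h2 => hne ⟨h1, h2⟩
          simp [h1, h2]
        · have h1 : (balogPair l).1 ≠ i := fun h1 => hne ⟨h1, h2⟩
          simp [h1, h2]
      · rw [linearPart_balogSystem, hk]
        simp
    · refine not_memAffLinSpan_of_witness (fun m => if m = j then (1 : ℤ) else 0)
        (fun l hl => ?_) ?_
      · rw [Finset.mem_filter] at hl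
        obtain ⟨-, hlk, hil⟩ := hl
        rw [linearPart_balogSystem]
        have hle := balogPair_le l
        have ha : (balogPair l).1 ≠ j := by
          intro ha
          rcases hil with h1 | h2
          · exact hd (h1.symm.trans ha)
          · exact hd (le_antisymm hij (by rw [← ha, ← h2]; exact hle))
        have hb : (balogPair l).2 ≠ j := by
          intro hb
          rcases hil with h1 | h2
          · exact hlk (hPk l (Prod.ext h1 hb))
          · exact hd (h2.symm.trans hb)
        simp [ha, hb]
      · rw [linearPart_balogSystem, hk]
        simp [hd]
  · -- the class of forms avoiding `nᵢ`
    simp only [Matrix.cons_val_one, Matrix.cons_val_zero]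
    refine not_memAffLinSpan_of_witness (fun m => if m = i then (1 : ℤ) else 0)
      (fun l hl => ?_) ?_
    · rw [Finset.mem_filter] at hl
      obtain ⟨-, hil⟩ := hl
      push Not at hil
      rw [linearPart_balogSystem]
      simp [hil.1, hil.2]
    · rw [linearPart_balogSystem, hk]
      by_cases h : j = i <;> simp [h]

/-- The Balog system satisfies the standing hypotheses of Def. 1.1.
[cite: GreenTao2010, Example 4 and Lemma 1.6] -/
theorem isNondegenerateSystem_balogSystem (d : ℕ) : IsNondegenerateSystem (balogSystem d) :=
  isNondegenerateSystem_of_complexity_le (complexity_balogSystem_le_one d)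

/-- Size: each form has `∑ⱼ |ψ̇(eⱼ)| = 2` and constant `1`, so `‖Ψ‖_N ≤ 3 · #forms` for `N ≥ 1`.
[cite: GreenTao2010, (1.1) and Example 4] -/
theorem affLinSize_balogSystem_le {N : ℝ} (hN : 1 ≤ N) :
    affLinSize (balogSystem d) N ≤ (3 * balogCount d : ℕ) := by
  classical
  unfold affLinSize
  have h1 : ∀ k : Fin (balogCount d), ∑ l, |((balogSystem d k).coeff l : ℝ)| ≤ 2 := by
    intro k
    have : ∀ l, |((balogSystem d k).coeff l : ℝ)| =
        (if l = (balogPair k).1 then 1 else 0) + (if l = (balogPair k).2 then 1 else 0) := by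
      intro l
      simp only [balogSystem, balogForm]
      split_ifs <;> norm_num
    simp only [this, Finset.sum_add_distrib, Finset.sum_ite_eq', Finset.mem_univ, if_true]
    norm_num
  have h2 : ∀ k : Fin (balogCount d), |((balogSystem d k).const : ℝ) / N| ≤ 1 := by
    intro k
    simp only [balogSystem, balogForm_const, Int.cast_one]
    rw [abs_of_nonneg (by positivity), div_le_one (by linarith)]
    exact hN
  calc ∑ k, ∑ l, |((balogSystem d k).coeff l : ℝ)| + ∑ k, |((balogSystem d k).const : ℝ) / N|
      ≤ ∑ k : Fin (balogCount d), (2 : ℝ) + ∑ k : Fin (balogCount d), (1 : ℝ) :=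
        add_le_add (Finset.sum_le_sum fun k _ => h1 k) (Finset.sum_le_sum fun k _ => h2 k)
    _ = (3 * balogCount d : ℕ) := by
        simp only [Finset.sum_const, Finset.card_univ, Fintype.card_fin, nsmul_eq_mul]
        push_cast
        ring

/-! ### Local solvability and positivity -/

/-- No local obstruction: at `n = 0` every form equals `1`. [cite: GreenTao2010, Example 4 and Cor. 1.9] -/
theorem balogSystem_locallySolvable (d p : ℕ) (hp : p.Prime) :
    ∃ n : Fin d → ℤ, ∀ k, ¬ ((p : ℤ) ∣ (balogSystem d k).eval n) := by
  refine ⟨0, fun k h => ?_⟩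
  rw [eval_balogSystem] at h
  simp only [Pi.zero_apply, add_zero, zero_add] at h
  exact hp.one_lt.ne' (by exact_mod_cast Int.eq_one_of_dvd_one (by exact_mod_cast hp.pos.le) h)

/-! ### The theorems -/

/-- **The generalised Hardy–Littlewood asymptotic for the Balog system, unconditionally**: for every
`ε > 0`, eventually in `N`, for every convex `K ⊆ [−N, N]^d`,
`|∑_{n ∈ K ∩ ℤ^d} ∏_{i ≤ j} Λ(nᵢ + nⱼ + 1) − β_∞(K) ∏_p β_p| ≤ ε N^d`.
[cite: GreenTao2010, Main Theorem and Example 4] -/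
theorem balog_vonMangoldt_asymptotic (hd : 1 ≤ d) :
    ∀ ε : ℝ, 0 < ε → ∃ N₀ : ℕ, ∀ N : ℕ, N₀ ≤ N →
      ∀ K : Set (Fin d → ℝ), Convex ℝ K → K ⊆ realBox d N →
        |vonMangoldtSum (balogSystem d) K N -
            archFactor (balogSystem d) K * singularProduct (balogSystem d)| ≤ ε * (N : ℝ) ^ d := by
  intro ε hε
  obtain ⟨N₀, hN₀⟩ := GreenTao2010_mainTheoremAtComplexity_one d (balogCount d) (3 * balogCount d)
    hd (one_le_balogCount hd) ε hε
  refine ⟨max N₀ 1, fun N hN K hK hKN => hN₀ N (le_trans (le_max_left _ _) hN) _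
    (isNondegenerateSystem_balogSystem d) (complexity_balogSystem_le_one d)
    (affLinSize_balogSystem_le (by exact_mod_cast le_trans (le_max_right _ _) hN)) K hK hKN⟩

/-- **Infinitely many all-prime points of the Balog system in the positive orthant**
(Cor. 1.9 at complexity `1`): infinitely many `n ∈ ℤ^d` with all `n_l > 0` and all
`nᵢ + nⱼ + 1` (`i ≤ j` enumerated) prime. [cite: GreenTao2010, Cor. 1.9 and Example 4] -/
theorem balogSystem_allPrime_infinite (hd : 1 ≤ d) :
    {n : Fin d → ℤ | (∀ l, 0 < n l) ∧ ∀ k, ((balogSystem d k).eval n).toNat.Prime}.Infinite := by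
  set K : Set (Fin d → ℝ) := Set.pi Set.univ fun _ => Set.Ioi (0 : ℝ) with hKdef
  have hKo : IsOpen K := isOpen_set_pi Set.finite_univ fun _ _ => isOpen_Ioi
  have hKc : Convex ℝ K := convex_pi fun _ _ => convex_Ioi _
  have hcone : ∀ r : ℝ, 0 < r → ∀ x ∈ K, r • x ∈ K := by
    intro r hr x hx
    simp only [hKdef, Set.mem_univ_pi, Set.mem_Ioi] at hx ⊢
    exact fun l => by simpa using mul_pos hr (hx l)
  have hpos : ∃ n : Fin d → ℤ, realPoint n ∈ K ∧ ∀ k, 0 < (balogSystem d k).linearPart n := by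
    refine ⟨fun _ => 1, ?_, fun k => ?_⟩
    · simp [hKdef, realPoint]
    · rw [linearPart_balogSystem]; norm_num
  have h := GreenTao2010_corollary19_atComplexity_one hd (one_le_balogCount hd) (balogSystem d)
    (complexity_balogSystem_le_one d) hKo hKc hcone (fun p hp => balogSystem_locallySolvable d p hp)
    hpos
  refine h.mono fun n hn => ⟨fun l => ?_, hn.2⟩
  have := hn.1
  simp only [hKdef, Set.mem_univ_pi, Set.mem_Ioi, realPoint] at this
  exact_mod_cast this l

/-- **Balog's theorem, midpoint form**: for every `d ≥ 1` there are infinitely many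
`n ∈ ℤ^d_{>0}` such that `nₐ + n_b + 1` is prime for ALL `a, b` — i.e. the odd numbers
`pₐ = 2nₐ + 1` are prime and all their means `½(pₐ + p_b) = nₐ + n_b + 1` are prime.
(Balog [Balog1992] proved this by the circle method; here it is an instance of the Green–Tao Main
Theorem at complexity `1`.) [cite: GreenTao2010, Example 4 and Cor. 1.9] -/
theorem balog_pairwiseMeans_infinite (hd : 1 ≤ d) :
    {n : Fin d → ℤ | (∀ l, 0 < n l) ∧ ∀ a b : Fin d, (n a + n b + 1).toNat.Prime}.Infinite := by
  refine (balogSystem_allPrime_infinite hd).mono fun n hn => ⟨hn.1, fun a b => ?_⟩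
  rcases le_total a b with h | h
  · obtain ⟨k, hk⟩ := exists_balogPair_eq h
    have := hn.2 k
    rwa [eval_balogSystem, hk] at this
  · obtain ⟨k, hk⟩ := exists_balogPair_eq h
    have := hn.2 k
    rw [eval_balogSystem, hk] at this
    rwa [add_comm (n a)]

/-- **Balog's theorem** (A. Balog 1992; Green–Tao 2010 Example 4, now an unconditional instance of
the Main Theorem at complexity `1`): for every `d ≥ 1` there are infinitely many `d`-tuples
`(p₁, …, p_d)` of primes such that every `pₐ + p_b` is even and every mean `½(pₐ + p_b)` is
prime. (The original [Balog1992] is not held in our corpus, so no theorem number of it is quoted; the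
statement is the one Green–Tao attribute to it in Example 4.) [cite: GreenTao2010, Example 4 and Cor. 1.9] -/
theorem balog_primeTuples_infinite (hd : 1 ≤ d) :
    {p : Fin d → ℕ | ∀ a b : Fin d,
      (p a).Prime ∧ Even (p a + p b) ∧ ((p a + p b) / 2).Prime}.Infinite := by
  set f : (Fin d → ℤ) → (Fin d → ℕ) := fun n a => 2 * (n a).toNat + 1 with hf
  have hinj : Set.InjOn f {n : Fin d → ℤ | (∀ l, 0 < n l) ∧
      ∀ a b : Fin d, (n a + n b + 1).toNat.Prime} := by
    intro n hn n' hn' h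
    funext a
    have h1 := congr_fun h a
    simp only [hf] at h1
    have h2 : (n a).toNat = (n' a).toNat := by omega
    have h3 := Int.toNat_of_nonneg (hn.1 a).le
    have h4 := Int.toNat_of_nonneg (hn'.1 a).le
    rw [← h3, ← h4, h2]
  refine ((balog_pairwiseMeans_infinite hd).image hinj).mono ?_
  rintro _ ⟨n, hn, rfl⟩ a b
  have key : ∀ a b : Fin d, (n a).toNat + (n b).toNat + 1 = (n a + n b + 1).toNat := by
    intro a b
    have ha := Int.toNat_of_nonneg (hn.1 a).le
    have hb := Int.toNat_of_nonneg (hn.1 b).le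
    omega
  refine ⟨?_, ⟨(n a).toNat + (n b).toNat + 1, by simp only [hf]; ring⟩, ?_⟩
  · have := hn.2 a a
    rw [← key] at this
    simp only [hf]
    convert this using 1
    ring
  · have := hn.2 a b
    rw [← key] at this
    simp only [hf]
    convert this using 1
    omega

end Literature.NumberTheory.Sieve

end
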